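import Summits.KontsevichZagierPeriods.KontsevichZagierPeriods.Theses.SymplecticScissors
import Literature.NumberTheory.Transcendental.AyoubPeriodSeries
import Literature.NumberTheory.Transcendental.AyoubPeriodSeriesKernel
import Literature.NumberTheory.Transcendental.AyoubPeriodSeriesPiAlgebraic
import Literature.NumberTheory.Transcendental.AyoubPeriodSeriesLocalizing
import Summits.KontsevichZagierPeriods.KontsevichZagierPeriods.Theorems.UnfoldedStokesStokesGenerationStubSpanToRepsAuxCoeff
import Mathlib.RingTheory.MvPowerSeries.Rename
import Mathlib.RingTheory.MvPowerSeries.Substitution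
import Mathlib.RingTheory.MvPowerSeries.Inverse
import Mathlib.RingTheory.PowerSeries.Basic
import Mathlib.RingTheory.PowerSeries.Substitution
import Mathlib.RingTheory.PowerSeries.WellKnown

/-!
# `TypeAGeneration` (stmt-KontsevichZagierPeriods-18392), line `Sketch`: stub `stub_geometricMajorant_of` (U1a)

Crux `Summit.KontsevichZagierPeriods.KontsevichZagierPeriods.Theses.SymplecticScissors.TypeAGeneration`
(Ayoub 2015 Conj. 1.1 = Fresán 2024 Conj. 3.5), line `Sketch` (radius amplification inside Ayoub's
algebra `𝒪_{k-alg}(𝔻̄^∞) = AyoubRel.Oan σ`). **Stub U1a** — the geometric series of a small element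
in the weighted `ℓ¹` algebra: given submultiplicativity of the weighted norm
`N_ρ(F) = Σ_a ‖F_a‖ ρ^a` (U0, a hypothesis here), for `ψ ∈ ℂ[[z]]` with zero constant coefficient
and `N_ρ(ψ) ≤ q < 1`, the substitution `V' = Σ_m ψ^m` of `ψ` into the univariate geometric series
`G = Σ_m X^m = PowerSeries.mk 1` satisfies `(1 − ψ) V' = 1`, `N_ρ(V') ≤ 1/(1 − q)`, and involves
only variables of `ψ`.

Proof (all `[folklore]`; no definition is introduced):

* `u1_one_sub_mul_subst`: `(1 − X) G = 1` in `ℂ[[X]]` (`PowerSeries.mk_one_mul_one_sub_eq_one`),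
  pushed through the substitution algebra homomorphism `X ↦ ψ`;
* `u1_coeff_subst`: `V'_e = Σᶠ_m (ψ^m)_e`, a finite sum (`PowerSeries.coeff_subst`);
* `u1_weights`: with `n_m = N_ρ(ψ^m) ≤ A^m` (induction on `m` from U0, `A = N_ρ(ψ) ≤ q`), the
  non-negative family `(m, e) ↦ ‖(ψ^m)_e‖ ρ^e` is summable with sum `Σ_m n_m ≤ Σ_m A^m = (1 − A)⁻¹`
  (Tonelli, `summable_prod_of_nonneg`, `HasSum.prod_fiberwise`), and its `e`-fibre sums dominate
  `‖V'_e‖ ρ^e`;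
* `u1_usesVar_subst`: a variable not involved in `ψ` is involved in no `ψ^m` (`usesVar_mul`), hence
  not in `V'`.
-/

noncomputable section

-- `Summit.KontsevichZagierPeriods.KontsevichZagierPeriods.…` is the tree's mandated layout (single-conjunct summit).
set_option linter.dupNamespace false

namespace Summit.KontsevichZagierPeriods.KontsevichZagierPeriods.TypeAGenerationLine

open Finsupp MvPowerSeries
open Literature.NumberTheory.Transcendental
open Literature.NumberTheory.Transcendental.AyoubRel
open Summit.KontsevichZagierPeriods.KontsevichZagierPeriods.Theses.SymplecticScissors (TypeAGeneration)

/-! ## The substitution `V' = G(ψ)`, `G = Σ_m X^m` -/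

/-- A series with zero constant coefficient can be substituted into a univariate power series.
[folklore] -/
theorem u1_hasSubst {ψ : CSeries} (hψ : MvPowerSeries.constantCoeff ψ = 0) :
    PowerSeries.HasSubst ψ :=
  PowerSeries.HasSubst.of_constantCoeff_zero hψ

/-- The substitution of the one-element family `() ↦ ψ` is `PowerSeries.subst ψ`. [folklore] -/
theorem u1_subst_eq (ψ : CSeries) :
    MvPowerSeries.subst (fun _ : Unit => ψ) (PowerSeries.mk fun _ : ℕ => (1 : ℂ)) =
      PowerSeries.subst ψ (PowerSeries.mk fun _ : ℕ => (1 : ℂ)) :=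
  rfl

/-- `(1 − X) · Σ_m X^m = 1` in `ℂ[[X]]`. [folklore] -/
theorem u1_one_sub_X_mul_mk_one :
    ((1 : PowerSeries ℂ) - PowerSeries.X) * PowerSeries.mk (fun _ : ℕ => (1 : ℂ)) = 1 := by
  rw [mul_comm]
  exact PowerSeries.mk_one_mul_one_sub_eq_one ℂ

/-- **`(1 − ψ) V' = 1`**: the identity `(1 − X) G = 1` pushed through the substitution `X ↦ ψ`
(an algebra homomorphism). [folklore] -/
theorem u1_one_sub_mul_subst {ψ : CSeries} (hψ : MvPowerSeries.constantCoeff ψ = 0) :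
    (1 - ψ) * PowerSeries.subst ψ (PowerSeries.mk fun _ : ℕ => (1 : ℂ)) = 1 := by
  have ha := u1_hasSubst hψ
  have h := congrArg (PowerSeries.subst ψ) u1_one_sub_X_mul_mk_one
  rw [PowerSeries.subst_mul ha, PowerSeries.subst_sub ha, PowerSeries.subst_X ha,
    ← PowerSeries.coe_substAlgHom ha, map_one] at h
  rw [← PowerSeries.coe_substAlgHom ha]
  exact h

/-- **Coefficients of `V'`**: `V'_e = Σᶠ_m (ψ^m)_e`. [folklore] -/
theorem u1_coeff_subst {ψ : CSeries} (hψ : MvPowerSeries.constantCoeff ψ = 0) (e : ℕ →₀ ℕ) :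
    coeff e (PowerSeries.subst ψ (PowerSeries.mk fun _ : ℕ => (1 : ℂ))) =
      ∑ᶠ m : ℕ, coeff e (ψ ^ m) := by
  rw [PowerSeries.coeff_subst (u1_hasSubst hψ)]
  exact finsum_congr fun m => by rw [PowerSeries.coeff_mk, one_smul]

/-- For fixed `e`, only finitely many `(ψ^m)_e` are non-zero. [folklore] -/
theorem u1_coeff_pow_finite {ψ : CSeries} (hψ : MvPowerSeries.constantCoeff ψ = 0) (e : ℕ →₀ ℕ) :
    (Function.support fun m : ℕ => coeff e (ψ ^ m)).Finite := by
  have h := PowerSeries.coeff_subst_finite (u1_hasSubst hψ) (PowerSeries.mk fun _ : ℕ => (1 : ℂ)) e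
  refine h.subset fun m hm => ?_
  rw [Function.mem_support] at hm ⊢
  rwa [PowerSeries.coeff_mk, one_smul]

/-! ## Variables of `V'` -/

/-- A variable not involved in `ψ` is involved in no power `ψ^m`. [folklore] -/
theorem u1_not_usesVar_pow {ψ : CSeries} {l : ℕ} (h : ¬ UsesVar ψ l) : ∀ m : ℕ, ¬ UsesVar (ψ ^ m) l
  | 0 => by
    rw [pow_zero]
    exact not_usesVar_one l
  | m + 1 => by
    rw [pow_succ]
    intro hm
    rcases usesVar_mul hm with h' | h'
    · exact u1_not_usesVar_pow h m h'
    · exact h h'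

/-- **`V'` involves only variables of `ψ`.** [folklore] -/
theorem u1_usesVar_subst {ψ : CSeries} (hψ : MvPowerSeries.constantCoeff ψ = 0) {l : ℕ}
    (h : UsesVar (PowerSeries.subst ψ (PowerSeries.mk fun _ : ℕ => (1 : ℂ))) l) : UsesVar ψ l := by
  by_contra hno
  obtain ⟨a, hal, hne⟩ := h
  apply hne
  rw [u1_coeff_subst hψ a]
  have h0 : ∀ m : ℕ, coeff a (ψ ^ m) = 0 := fun m => by
    by_contra hm
    exact u1_not_usesVar_pow hno m ⟨a, hal, hm⟩
  simp only [h0, finsum_zero]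

/-! ## Weights: `N_ρ(V') ≤ Σ_m N_ρ(ψ)^m` -/

/-- `N(ψ^m) ≤ A^m` for `N(ψ) = A`, by induction from submultiplicativity (`N(1) = 1` as `w 0 = 1`).
[folklore] -/
theorem u1_pow_hasSum {w : (ℕ →₀ ℕ) → ℝ} (hw : ∀ a, 0 ≤ w a) (hw0 : w 0 = 1)
    (hmul : ∀ (F G : CSeries) (A B : ℝ), HasSum (fun a : ℕ →₀ ℕ => ‖coeff a F‖ * w a) A →
      HasSum (fun a : ℕ →₀ ℕ => ‖coeff a G‖ * w a) B →
        ∃ P : ℝ, P ≤ A * B ∧ HasSum (fun a : ℕ →₀ ℕ => ‖coeff a (F * G)‖ * w a) P)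
    {ψ : CSeries} {A : ℝ} (hA : HasSum (fun a : ℕ →₀ ℕ => ‖coeff a ψ‖ * w a) A) :
    ∀ m : ℕ, ∃ n : ℝ, n ≤ A ^ m ∧ HasSum (fun a : ℕ →₀ ℕ => ‖coeff a (ψ ^ m)‖ * w a) n
  | 0 => by
    refine ⟨‖coeff (0 : ℕ →₀ ℕ) (ψ ^ 0)‖ * w 0, ?_, hasSum_single 0 fun b hb => ?_⟩
    · rw [pow_zero, pow_zero, coeff_zero_one, norm_one, one_mul, hw0]
    · rw [pow_zero, coeff_one, if_neg hb, norm_zero, zero_mul]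
  | m + 1 => by
    obtain ⟨n, hn, hs⟩ := u1_pow_hasSum hw hw0 hmul hA m
    obtain ⟨P, hP, hS⟩ := hmul (ψ ^ m) ψ n A hs hA
    have hA0 : 0 ≤ A := hA.nonneg fun a => mul_nonneg (norm_nonneg _) (hw a)
    refine ⟨P, hP.trans ?_, by rwa [pow_succ]⟩
    rw [pow_succ]
    exact mul_le_mul_of_nonneg_right hn hA0

/-- **The weights of `V'`**: `N_ρ(V') ≤ 1/(1 − q)` whenever `N_ρ(ψ) ≤ q < 1` (the family
`(m, e) ↦ ‖(ψ^m)_e‖ ρ^e` is summable with sum `Σ_m N_ρ(ψ^m) ≤ Σ_m N_ρ(ψ)^m`, and its fibre sums over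
`m` dominate `‖V'_e‖ ρ^e`). [folklore] -/
theorem u1_weights {w : (ℕ →₀ ℕ) → ℝ} (hw : ∀ a, 0 ≤ w a) (hw0 : w 0 = 1)
    (hmul : ∀ (F G : CSeries) (A B : ℝ), HasSum (fun a : ℕ →₀ ℕ => ‖coeff a F‖ * w a) A →
      HasSum (fun a : ℕ →₀ ℕ => ‖coeff a G‖ * w a) B →
        ∃ P : ℝ, P ≤ A * B ∧ HasSum (fun a : ℕ →₀ ℕ => ‖coeff a (F * G)‖ * w a) P)
    {ψ : CSeries} (hψ : MvPowerSeries.constantCoeff ψ = 0) {q A : ℝ} (hq : q < 1) (hAq : A ≤ q)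
    (hA : HasSum (fun a : ℕ →₀ ℕ => ‖coeff a ψ‖ * w a) A) :
    ∃ P : ℝ, P ≤ 1 / (1 - q) ∧
      HasSum (fun a : ℕ →₀ ℕ =>
        ‖coeff a (PowerSeries.subst ψ (PowerSeries.mk fun _ : ℕ => (1 : ℂ)))‖ * w a) P := by
  have hA0 : 0 ≤ A := hA.nonneg fun a => mul_nonneg (norm_nonneg _) (hw a)
  have hA1 : A < 1 := hAq.trans_lt hq
  -- `N m = N_ρ(ψ^m) ≤ A^m`
  set N : ℕ → ℝ := fun m => ∑' a : ℕ →₀ ℕ, ‖coeff a (ψ ^ m)‖ * w a with hN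
  have hNs : ∀ m, HasSum (fun a : ℕ →₀ ℕ => ‖coeff a (ψ ^ m)‖ * w a) (N m) := fun m => by
    obtain ⟨n, -, hs⟩ := u1_pow_hasSum hw hw0 hmul hA m
    exact hs.summable.hasSum
  have hNle : ∀ m, N m ≤ A ^ m := fun m => by
    obtain ⟨n, hn, hs⟩ := u1_pow_hasSum hw hw0 hmul hA m
    rwa [← hs.tsum_eq] at hn
  have hN0 : ∀ m, 0 ≤ N m := fun m => tsum_nonneg fun a => mul_nonneg (norm_nonneg _) (hw a)
  -- the double family
  set H : ℕ × (ℕ →₀ ℕ) → ℝ := fun p => ‖coeff p.2 (ψ ^ p.1)‖ * w p.2 with hH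
  have hH0 : 0 ≤ H := fun p => mul_nonneg (norm_nonneg _) (hw p.2)
  have hHs : Summable H :=
    (summable_prod_of_nonneg hH0).2
      ⟨fun m => (hNs m).summable, Summable.of_nonneg_of_le hN0 hNle (summable_geometric_of_lt_one hA0 hA1)⟩
  have hNT : HasSum N (∑' p, H p) := hHs.hasSum.prod_fiberwise hNs
  have hT : ∑' p, H p ≤ (1 - A)⁻¹ := hasSum_le hNle hNT (hasSum_geometric_of_lt_one hA0 hA1)
  -- the swapped family and its fibre sums over `m`
  have hH' : HasSum (fun p : (ℕ →₀ ℕ) × ℕ => ‖coeff p.1 (ψ ^ p.2)‖ * w p.1) (∑' p, H p) :=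
    (Equiv.prodComm (ℕ →₀ ℕ) ℕ).hasSum_iff.2 hHs.hasSum
  have hg : HasSum (fun e : ℕ →₀ ℕ => ∑' m : ℕ, ‖coeff e (ψ ^ m)‖ * w e) (∑' p, H p) :=
    hH'.prod_fiberwise fun e => (hH'.summable.prod_factor e).hasSum
  -- domination of `‖V'_e‖ ρ^e`
  have hfg : ∀ e : ℕ →₀ ℕ,
      ‖coeff e (PowerSeries.subst ψ (PowerSeries.mk fun _ : ℕ => (1 : ℂ)))‖ * w e ≤
        ∑' m : ℕ, ‖coeff e (ψ ^ m)‖ * w e := fun e => by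
    rw [u1_coeff_subst hψ e, finsum_eq_sum_of_support_subset _
      (s := (u1_coeff_pow_finite hψ e).toFinset) (by rw [Set.Finite.coe_toFinset])]
    calc ‖∑ m ∈ (u1_coeff_pow_finite hψ e).toFinset, coeff e (ψ ^ m)‖ * w e
        ≤ (∑ m ∈ (u1_coeff_pow_finite hψ e).toFinset, ‖coeff e (ψ ^ m)‖) * w e :=
          mul_le_mul_of_nonneg_right (norm_sum_le _ _) (hw e)
      _ = ∑ m ∈ (u1_coeff_pow_finite hψ e).toFinset, ‖coeff e (ψ ^ m)‖ * w e := Finset.sum_mul _ _ _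
      _ ≤ ∑' m : ℕ, ‖coeff e (ψ ^ m)‖ * w e :=
          (hH'.summable.prod_factor e).sum_le_tsum _ fun m _ => mul_nonneg (norm_nonneg _) (hw e)
  have hf0 : ∀ e : ℕ →₀ ℕ,
      0 ≤ ‖coeff e (PowerSeries.subst ψ (PowerSeries.mk fun _ : ℕ => (1 : ℂ)))‖ * w e := fun e =>
    mul_nonneg (norm_nonneg _) (hw e)
  have hf : Summable fun e : ℕ →₀ ℕ =>
      ‖coeff e (PowerSeries.subst ψ (PowerSeries.mk fun _ : ℕ => (1 : ℂ)))‖ * w e :=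
    Summable.of_nonneg_of_le hf0 hfg hg.summable
  refine ⟨_, ?_, hf.hasSum⟩
  calc ∑' e : ℕ →₀ ℕ, ‖coeff e (PowerSeries.subst ψ (PowerSeries.mk fun _ : ℕ => (1 : ℂ)))‖ * w e
      ≤ ∑' p, H p := hasSum_le hfg hf.hasSum hg
    _ ≤ (1 - A)⁻¹ := hT
    _ ≤ 1 / (1 - q) := by
        rw [one_div]
        exact inv_anti₀ (sub_pos.2 hq) (sub_le_sub_left hAq 1)

/-! ## The stub -/

/-- U1a — the geometric series of a small element: for `ψ` with zero constant coefficient and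
`N_ρ(ψ) ≤ q < 1`, the substitution `V' = Σ_m ψ^m` of `ψ` into the univariate geometric series
satisfies `(1 − ψ) V' = 1`, `N_ρ(V') ≤ 1/(1−q)`, and uses only variables of `ψ` (given U0). [folklore] -/
theorem stub_geometricMajorant_of :
    (∀ (F G : CSeries) (ρ : ℕ → ℝ), (∀ l, 0 ≤ ρ l) →
      ∀ (A B : ℝ),
        HasSum (fun a : ℕ →₀ ℕ => ‖MvPowerSeries.coeff a F‖ * a.prod fun l n => ρ l ^ n) A →
        HasSum (fun a : ℕ →₀ ℕ => ‖MvPowerSeries.coeff a G‖ * a.prod fun l n => ρ l ^ n) B →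
        ∃ P : ℝ, P ≤ A * B ∧
          HasSum (fun a : ℕ →₀ ℕ => ‖MvPowerSeries.coeff a (F * G)‖ * a.prod fun l n => ρ l ^ n) P) →
    ∀ (ψ : CSeries), MvPowerSeries.constantCoeff ψ = 0 →
      ∀ (ρ : ℕ → ℝ), (∀ l, 0 ≤ ρ l) → ∀ (q : ℝ), q < 1 →
        (∃ A : ℝ, A ≤ q ∧
          HasSum (fun a : ℕ →₀ ℕ => ‖MvPowerSeries.coeff a ψ‖ * a.prod fun l n => ρ l ^ n) A) →
        (1 - ψ) * MvPowerSeries.subst (fun _ : Unit => ψ) (PowerSeries.mk fun _ : ℕ => (1 : ℂ)) = 1 ∧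
        (∃ P : ℝ, P ≤ 1 / (1 - q) ∧
          HasSum (fun a : ℕ →₀ ℕ =>
            ‖MvPowerSeries.coeff a (MvPowerSeries.subst (fun _ : Unit => ψ) (PowerSeries.mk fun _ : ℕ => (1 : ℂ)))‖ *
              a.prod fun l n => ρ l ^ n) P) ∧
        (∀ l : ℕ, UsesVar (MvPowerSeries.subst (fun _ : Unit => ψ) (PowerSeries.mk fun _ : ℕ => (1 : ℂ))) l →
          UsesVar ψ l) := by
  intro hU0 ψ hψ ρ hρ q hq hAex
  obtain ⟨A, hAq, hA⟩ := hAex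
  rw [u1_subst_eq]
  refine ⟨u1_one_sub_mul_subst hψ, ?_, fun l hl => u1_usesVar_subst hψ hl⟩
  exact u1_weights (w := fun a : ℕ →₀ ℕ => a.prod fun l n => ρ l ^ n)
    (fun a => Finset.prod_nonneg fun l _ => pow_nonneg (hρ l) _) Finsupp.prod_zero_index
    (fun F G A B hF hG => hU0 F G ρ hρ A B hF hG) hψ hq hAq hA

end Summit.KontsevichZagierPeriods.KontsevichZagierPeriods.TypeAGenerationLine
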